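import Literature.AlgebraicGeometry.Resolution.PatchingMorphismStep
import Literature.AlgebraicGeometry.Resolution.QuadraticTransformsFactorization
import Literature.AlgebraicGeometry.CossartPiltant200819.RefinedPatchingVerbatim2008
import HarnessLib

/-!
# Cossart–Piltant 2008, Proposition 4.8 VERBATIM (Zariski's Theorem 7: elimination of the regular fundamental points of a birational map of threefolds)

Companion of `RefinedPatchingVerbatim2008.lean` (Prop 4.9) and `Thm21Verbatim2008.lean`
(Thm 2.1).  The printed text (HAL p. 15; [46] = Zariski, Ann. Math. 45 (1944), [12] = Cossart,
Math. Ann. 293 (1992), [2] = Abhyankar, Amer. J. Math. 78 (1956)):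

> "Proposition 4.9 below is a refined version of Zariski's patching theorem ([46] Fundamental
> Theorem on p. 539) in characteristic zero. We first indicate why this result remains true over
> any base field `k` of positive characteristic. As written on p. 539 of [46], two preliminary
> results are required: theorem 7 (elimination of regular points in the fundamental locus of a
> birational map of threefolds) and the lemma in section 24 (local factorisation of birational
> morphisms of regular surfaces) of loc.cit.. […] Proposition 4.7. ([2] theorem 3) […]
> Extending [46] theorem 7 to any base field is an easy consequence of proposition 4.1;
> Zariski's theorem 7 can be rephrased as follows:
>
> **Proposition 4.8.** Let `T : Z ⋯→ X` be a birational map between three-dimensional integral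
> projective varieties over `k` and `F ⊂ Z` be its fundamental locus. There exists a composition
> of blowing ups with regular centers `q : Z′ → Z` such that no point of `q⁻¹(F ∩ Z_reg)` is
> fundamental for `q ∘ T`.
>
> Proof. Let `Z̃` be the closure of the graph of the birational map `T`. Then `Z̃` is
> projective, i.e. the blowing up of a certain ideal sheaf `I ⊂ O_Y`. We apply proposition 4.2
> to the quasiprojective variety `U := Z_reg` and the ideal sheaf `I|_U`. Each blowing up center
> `Y(j) ⊂ U(j)` is either a closed point or a regular curve. For each `j`, `0 ≤ j ≤ n − 1`, we
> define inductively a projective variety `Z(j)` containing `U(j)` as a dense open subset as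
> follows, with `Z(0) := Z` to begin with: 1- if `Y(j)` is a closed point, let `Z(j + 1)` be
> the blowing up of `Z(j)` along `Y(j)`; 2- if `Y(j)` is a regular curve, let `Ȳ(j)` be its
> Zariski closure in `Z(j)`. Let `Z(j + 1) → Z(j)` be the minimal composition of point blowing
> ups making the strict transform `Ȳ(j)′` of `Ȳ(j)` regular followed by the blowing up along
> `Ȳ(j)′`. Let `q : Z′ := Z(n) → Z` be the obtained map. By the universal property of blowing
> up, the birational map `q ∘ T` is defined on `q⁻¹(F ∩ Z_reg)` and this concludes the proof.
>
> To get (ii) in theorem 2.1, we need the following refinement of Zariski's patching theorem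
> which is due to the first author [12]. The proof in [12] is written for `k` algebraically
> closed, but only uses this assumption via propositions 4.7 and 4.8 above. Since these results
> have been seen to be valid for any ground field `k`, we thus have: Proposition 4.9. […]"

DICTIONARY (all entries are existing declarations of `Literature/AlgebraicGeometry/Resolution`,
after Zariski–Samuel II, Ch. VI §17, the language of [46] itself):
* "`Z`, `X` three-dimensional integral projective varieties over `k` with a birational map
  `T : Z ⋯→ X`" = two projective models `Z X : ProjModel k K` of one function field `K/k` of
  transcendence degree `3` (`ProjectiveModels.lean`: integral, projective over `k` — a closed
  `k`-immersion into some `ℙⁿ_k` —, `K ≅` the function field; `dim Z = trdeg_k K`,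
  `ProjModel.topologicalKrullDim_eq_of_trdeg`); `T` is the birational correspondence of the two
  models (given `T`, put `K := K(Z)` and read `X` as a model of `K` through `T^* : K(X) ≅ K(Z)`).
* "`T` is defined at `z`" / "`z` is not fundamental for `T`" = the local ring `𝒪_{Z,z} ⊆ K` has
  a centre on `X`, `X.HasCentre (Z.stalkSubring z)` (`ProjectiveModelsCentresLocal.lean`;
  Zariski–Samuel VI §17; equivalently, in homogeneous coordinates of `X ⊆ ℙⁿ_k`, the coordinate
  vector read in `K(Z)` is defined at `z`: `ProjModel.hasCentre_stalkSubring_iff_isDefinedAt`,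
  `RationalMapsOfModels.lean`); "the fundamental locus `F ⊂ Z`" = `fundamentalLocus Z X` below
  (closed, `isClosed_fundamentalLocus`; misses the generic point).
* "`q : Z′ → Z` a composition of blowing ups with regular centers", `Z′` again an integral
  projective variety birational to `Z` through `q` = a morphism of models `q : Z'.Hom Z`
  (`Z' : ProjModel k K`) whose underlying morphism satisfies the inductive predicate
  `IsRegularCentreBlowupComposition` below: finitely many blowing ups (universal property,
  `IsBlowup`, `Blowups.lean`), each along the reduced closed subscheme on a proper closed subset
  which is integral and regular ([46]: "monoidal transformations" with irreducible non-singular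
  centres; as in [CP-II] Prop. 4.4 (i), `IsRegularCentreBlowupSeq` of `Principalization.lean`,
  WITHOUT the clause "centre in the non-locally-principal locus of `J`" — Prop 4.8 names no
  ideal sheaf).  The composite rational map `q ∘ T : Z′ ⋯→ X` is the correspondence of the models
  `Z'`, `X`, so "no point of `q⁻¹(F ∩ Z_reg)` is fundamental for `q ∘ T`" =
  `∀ z', q z' ∈ F ∩ Reg Z → z' ∉ fundamentalLocus Z' X`.
* "`Z_reg`" = `Scheme.regularLocus Z.X`; any field `k` (the text: "any base field `k` of
  positive characteristic", characteristic zero being [46] Thm 7; the printed proof — Prop 4.2 and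
  the universal property of blowing up — is characteristic free).

CONTENTS:
* `IsRegularCentreBlowupComposition` + PROVED API (`isIntegral`, `isProper`, `isBirational`,
  `isProjectiveOver`, and `of_isRegularCentreBlowupSeq`: a Cossart–Piltant principalizing
  sequence is such a composition);
* `fundamentalLocus Z X` + PROVED API (closed; generic point not fundamental; coordinate form;
  fundamental points only decrease along morphisms of models; and
  `nonempty_hom_iff_fundamentalLocus_eq_empty`: `Z` dominates `X` — `T` is a morphism of models —
  iff `F = ∅`, Zariski–Samuel VI §17 / Hartshorne II 7.1);
* `EliminationOfRegularFundamentalPoints` — **Prop 4.8 VERBATIM** (named statement, NOT proved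
  here; used only as a hypothesis), and PROVED
  `eliminationOfRegularFundamentalPoints_iff_over_regularLocus`: the printed conclusion is
  equivalent to "no point of `q⁻¹(Z_reg)` is fundamental for `q ∘ T`" (over `Z_reg ∖ F` the map
  `T`, hence `q ∘ T`, is defined anyway);
* PROVED `exists_comp_forall_not_mem_fundamentalLocus_of_isRegular`: **Prop 4.8 for regular `Z`**
  (then `U = Z` and `q ∘ T` is a morphism) from the named fact
  `CossartPiltant2019Principalization` ([CP-II] Prop. 4.4 = [CP-I] Prop. 4.2 made
  characteristic free) — principalize the base ideal of the coordinate vector on `Z` itself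
  (`RationalMapBaseIdeal.lean`, Hartshorne II 7.17.3) —, i.e. elimination of the indeterminacies
  of a rational map from a regular projective threefold by blowing up regular centres
  (`exists_comp_nonempty_hom_of_isRegular`: `Z ← Z' → X` with `Z' → X` a morphism of models);
* PROVED `exists_hom_forall_not_mem_fundamentalLocus_of_regPrincipalization` (and
  `…_of_principalization`, `…_of_trdeg`): **Prop 4.8 for arbitrary `Z` in the form of Piltant's
  Axiom 4** ([cite: Piltant2013, §2 Axiom 4 (i)–(iii)], there with the remark "we do not require
  `π` to be a composition of elementary blowing ups (for example at integral or at regular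
  centers)"): a morphism of models `q : Z' → Z` which OVER `Z_reg` is (the base change of) a
  composition of blowing ups with regular integral centres, with `q⁻¹(Z_reg) ⊆ Reg Z'`, `q` an
  isomorphism over every open missing the closure of `F ∩ Z_reg`, and no point of `q⁻¹(Z_reg)`
  fundamental for `q ∘ T` — steps (2)–(7) of the tree's
  `ProjModel.exists_hom_regLe_isIso_of_regPrincipalization` (`PatchingMorphismStep.lean`, Piltant
  2013 Prop. 5.1 Step 2), which proves the definedness internally but does not export it.
  DEVIATION, recorded not hidden: the printed `q` has regular centres GLOBALLY (device 2- of the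
  proof: point blowing ups making the strict transform of the closure `Ȳ(j)` regular before
  blowing it up); the tree's extension of a sequence from the open `Z_reg` to `Z`
  (`IsRegularCentreBlowupSeq.exists_extension_full`) blows up the reduced closures of the centres,
  which may be singular off `Z_reg`, so the global regular-centre clause of the verbatim statement
  is NOT derived here for singular `Z` (it is for regular `Z`, previous item);
* `RefinedPatchingOfProps47And48` — the printed reduction "[12] only uses `k = k̄` via
  propositions 4.7 and 4.8" as a named implication `4.7 → 4.8 → 4.9` (NOT proved here: it is the
  content of [12]), and PROVED `refinedPatchingQuasiProjective_of_props47And48`: with the tree's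
  THEOREM `AbhyankarQuadraticFactorization_holds` (= Prop 4.7, [2] Thm 3, proved in
  `QuadraticTransformsFactorization.lean`) the printed Prop 4.9 follows from `[12] ∧ 4.8` alone.

CAVEAT.  Statement-level formalisation of a published proposition plus kernel-checked
bookkeeping and two derived forms; the named statements are used only as hypotheses.
AI-written; weaker than expert review.  NOT summit progress.
-/

noncomputable section

open CategoryTheory CategoryTheory.Limits AlgebraicGeometry TopologicalSpace IsLocalRing

universe u

namespace Literature.AlgebraicGeometry.CossartPiltant200819.CP2008

open Literature.AlgebraicGeometry.Resolution Literature.AlgebraicGeometry.Motives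
open MvPolynomial HomogeneousLocalization

attribute [local instance] MvPolynomial.gradedAlgebra

/-! ## Compositions of blowing ups with regular centres -/

/-- **`q : Z' → Z` is a composition of blowing ups with regular centers** ([CP-I] Prop 4.8;
[46] Thm 7: a product of monoidal transformations with non-singular irreducible centres): the
empty composition is the identity; a composition `q : Z' → Z` may be followed by a blowing up
`τ : Z'' → Z'` (universal property, `IsBlowup`) along the reduced closed subscheme on a proper
closed subset `Y ⊊ Z'` which is integral and regular.  This is `IsRegularCentreBlowupSeq`
([CP-II] Prop. 4.4 (i), `Principalization.lean`) without its clause "`Y` inside the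
non-locally-principal locus of the transform of `J`" (`of_isRegularCentreBlowupSeq`).
[cite: CossartPiltant2008, Prop 4.8 (HAL p. 15)] -/
inductive IsRegularCentreBlowupComposition :
    ∀ {Z' Z : Scheme.{u}}, (Z' ⟶ Z) → Prop
  /-- the empty composition -/
  | nil (Z : Scheme.{u}) : IsRegularCentreBlowupComposition (𝟙 Z)
  /-- one more blowing up along a proper, integral, regular centre -/
  | cons {Z'' Z' Z : Scheme.{u}} (τ : Z'' ⟶ Z') (q : Z' ⟶ Z) (Y : Closeds Z') :
      IsRegularCentreBlowupComposition q →
      (Y : Set Z') ≠ Set.univ →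
      IsIntegral (Scheme.IdealSheafData.vanishingIdeal Y).subscheme →
      Scheme.IsRegular (Scheme.IdealSheafData.vanishingIdeal Y).subscheme →
      IsBlowup τ (Scheme.IdealSheafData.vanishingIdeal Y) →
      IsRegularCentreBlowupComposition (τ ≫ q)

/-- The ideal sheaf of a proper closed subset is non-zero. [folklore] -/
theorem vanishingIdeal_ne_bot_of_ne_univ {Z : Scheme.{u}} (Y : Closeds Z)
    (hY : (Y : Set Z) ≠ Set.univ) : Scheme.IdealSheafData.vanishingIdeal Y ≠ ⊥ := fun h => hY <| by
  rw [← Scheme.IdealSheafData.coe_support_vanishingIdeal Y, h, Scheme.IdealSheafData.support_bot]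
  rfl

namespace IsRegularCentreBlowupComposition

/-- A single blowing up along a proper, integral, regular centre is a (one-step) composition.
[folklore] -/
theorem single {Z' Z : Scheme.{u}} (τ : Z' ⟶ Z) (Y : Closeds Z) (hY : (Y : Set Z) ≠ Set.univ)
    (hint : IsIntegral (Scheme.IdealSheafData.vanishingIdeal Y).subscheme)
    (hreg : Scheme.IsRegular (Scheme.IdealSheafData.vanishingIdeal Y).subscheme)
    (hτ : IsBlowup τ (Scheme.IdealSheafData.vanishingIdeal Y)) :
    IsRegularCentreBlowupComposition τ := by
  have h := cons τ (𝟙 Z) Y (nil Z) hY hint hreg hτ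
  rwa [Category.comp_id] at h

/-- **Every stage of a composition of blowing ups with (proper) centres over an integral scheme is
integral** (`IsBlowup.isIntegral`, Stacks 02ND). [cite: StacksProject, Tag 02ND] -/
theorem isIntegral : ∀ {Z' Z : Scheme.{u}} {q : Z' ⟶ Z}, IsRegularCentreBlowupComposition q →
    IsIntegral Z → IsIntegral Z' := by
  intro Z' Z q h
  induction h with
  | nil Z => exact id
  | cons τ q Y hq hY hint hreg hτ ih =>
    intro hZ
    haveI := ih hZ
    exact hτ.isIntegral (vanishingIdeal_ne_bot_of_ne_univ Y hY)

/-- **A composition of blowing ups over a locally Noetherian scheme is proper** (blowing ups of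
locally Noetherian schemes are proper, `IsBlowup.isProper`, GW Prop. 13.96 (1)).
[cite: GortzWedhorn2020, Prop. 13.96 (1)] -/
theorem isProper : ∀ {Z' Z : Scheme.{u}} {q : Z' ⟶ Z}, IsRegularCentreBlowupComposition q →
    IsLocallyNoetherian Z → IsProper q := by
  intro Z' Z q h
  induction h with
  | nil Z => exact fun _ => inferInstance
  | cons τ q Y hq hY hint hreg hτ ih =>
    intro hZ
    haveI := ih hZ
    haveI : IsLocallyNoetherian _ := LocallyOfFiniteType.isLocallyNoetherian q
    haveI := hτ.isProper
    infer_instance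

/-- **A composition of blowing ups with proper centres over an integral scheme is birational**
(`IsBlowup.isBirational'`, Stacks 02ND/02OS, and `IsBirational.comp`). [cite: StacksProject, Tag 02OS] -/
theorem isBirational : ∀ {Z' Z : Scheme.{u}} {q : Z' ⟶ Z}, IsRegularCentreBlowupComposition q →
    IsIntegral Z → IsBirational q := by
  intro Z' Z q h
  induction h with
  | nil Z => exact fun _ => isBirational_id Z
  | cons τ q Y hq hY hint hreg hτ ih =>
    intro hZ
    haveI := hq.isIntegral hZ
    exact (hτ.isBirational' (vanishingIdeal_ne_bot_of_ne_univ Y hY)).comp (ih hZ)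

/-- **A composition of blowing ups of a projective `k`-scheme is projective over `k`** (blowing
ups of projective schemes are projective, `IsBlowup.isProjectiveOver`, Hartshorne II 7.16 (c)).
[cite: Hartshorne1977, II Prop. 7.16 (c), p. 166] -/
theorem isProjectiveOver {k : Type u} [Field k] :
    ∀ {Z' Z : Scheme.{u}} {q : Z' ⟶ Z}, IsRegularCentreBlowupComposition q →
      ∀ f : Z ⟶ Spec (.of k), Motives.IsProjectiveOver (Over.mk f) →
        Motives.IsProjectiveOver (Over.mk (q ≫ f)) := by
  intro Z' Z q h
  induction h with
  | nil Z =>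
    intro f hf
    rwa [Category.id_comp]
  | cons τ q Y hq hY hint hreg hτ ih =>
    intro f hf
    rw [Category.assoc]
    exact hτ.isProjectiveOver (q ≫ f) (ih f hf)

/-- **A Cossart–Piltant principalizing sequence is a composition of blowing ups with regular
centers**: along `IsRegularCentreBlowupSeq σ J` with `J ≠ 0` on an integral locally Noetherian
scheme every centre lies in the non-locally-principal locus of the (non-zero) transform of `J`, a
proper closed subset (`nonPrincipalLocus_ne_top`). [cite: CossartPiltant2019, Prop. 4.4 (i) (arXiv v1: Prop. 4.3)] -/
theorem of_isRegularCentreBlowupSeq :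
    ∀ {S' S : Scheme.{u}} {σ : S' ⟶ S} {J : S.IdealSheafData}, IsRegularCentreBlowupSeq σ J →
      IsIntegral S → IsLocallyNoetherian S → J ≠ ⊥ → IsRegularCentreBlowupComposition σ := by
  intro S' S σ J h
  induction h with
  | nil J => exact fun _ _ _ => nil _
  | @cons S'' S' S τ σ J Y hσ hYint hYreg hY hτ ih =>
    intro hint hN hJ
    obtain ⟨hint', hN', hJ'⟩ := hσ.isIntegral_and_comap_ne_bot hint hN hJ
    haveI := hint'
    haveI := hN'
    refine cons τ σ Y (ih hint hN hJ) (fun hYu => nonPrincipalLocus_ne_top hJ' ?_) hYint hYreg hτ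
    refine TopologicalSpace.Closeds.ext ?_
    rw [TopologicalSpace.Closeds.coe_top, Set.eq_univ_iff_forall]
    intro y
    exact hY y (by rw [hYu]; trivial)

end IsRegularCentreBlowupComposition

/-! ## The fundamental locus of the birational correspondence of two models -/

variable {k K : Type u} [Field k] [Field K] [Algebra k K]

/-- **The fundamental locus `F ⊆ Z` of the birational map `T : Z ⋯→ X`** of two projective
models of `K/k`: the points `z` at which `T` is not defined, i.e. whose local ring
`𝒪_{Z,z} ⊆ K` has no centre on `X` (Zariski–Samuel II, Ch. VI §17; [46]: the fundamental
points of the birational correspondence). [cite: ZariskiSamuel1960, Ch. VI §17] -/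
def fundamentalLocus (Z X : ProjModel k K) : Set Z.X :=
  {z | ¬ X.HasCentre (Z.stalkSubring z)}

/-- Membership in the fundamental locus. [folklore] -/
@[simp] theorem mem_fundamentalLocus_iff (Z X : ProjModel k K) (z : Z.X) :
    z ∈ fundamentalLocus Z X ↔ ¬ X.HasCentre (Z.stalkSubring z) :=
  Iff.rfl

/-- **The fundamental locus is closed** (`ProjModel.isClosed_setOf_not_hasCentre`).
[cite: ZariskiSamuel1960, Ch. VI §17] -/
theorem isClosed_fundamentalLocus (Z X : ProjModel k K) : IsClosed (fundamentalLocus Z X) :=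
  ProjModel.isClosed_setOf_not_hasCentre Z X

/-- The generic point is never fundamental. [folklore] -/
theorem genericPoint_not_mem_fundamentalLocus (Z X : ProjModel k K) :
    genericPoint Z.X ∉ fundamentalLocus Z X :=
  fun h => h (ProjModel.hasCentre_stalkSubring_genericPoint Z X)

/-- **Coordinate form of the fundamental locus**: for a closed `k`-immersion `X ↪ ℙⁿ_k` with
homogeneous coordinates `w ∈ Kⁿ⁺¹` of the generic point of `X`, `F` is the indeterminacy locus
of the coordinate vector `(w₀ : … : wₙ)` read in `K(Z) ≅ K`
(`ProjModel.hasCentre_stalkSubring_iff_isDefinedAt`). [cite: ZariskiSamuel1960, Ch. VI §17] -/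
theorem fundamentalLocus_eq_setOf_not_isDefinedAt (Z X : ProjModel k K) {n : ℕ}
    (ιX : X.X ⟶ Proj (Segre.grading (Fin (n + 1)) k)) [IsClosedImmersion ιX]
    (hιX : ιX ≫ Segre.toSpec (Fin (n + 1)) k = X.π) (w : Fin (n + 1) → K) (hw : w ≠ 0)
    (hgenX : X.gen ≫ ιX = (ProjectiveSpace.pointOfVec k w hw).left) :
    fundamentalLocus Z X = {z | ¬ IsDefinedAt (fun l => Z.funFieldAlgEquiv.symm (w l)) z} := by
  ext z
  simp only [mem_fundamentalLocus_iff, Set.mem_setOf_eq,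
    ProjModel.hasCentre_stalkSubring_iff_isDefinedAt Z X ιX hιX w hw hgenX z]

/-- **A model dominating `X` has no fundamental points**: along a morphism of models
`φ : Z → X`, `𝒪_{X,φ z} ⊆ 𝒪_{Z,z}` is dominated (`ProjModel.stalkSubring_dominates_of_hom`), so
`φ z` is a centre of `𝒪_{Z,z}` on `X`. [cite: ZariskiSamuel1960, Ch. VI §17] -/
theorem fundamentalLocus_eq_empty_of_hom {Z X : ProjModel k K} (φ : Z.Hom X) :
    fundamentalLocus Z X = ∅ :=
  Set.eq_empty_iff_forall_notMem.mpr fun z hz =>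
    hz ⟨φ.f z, ProjModel.stalkSubring_dominates_of_hom φ z⟩

/-- **Fundamental points only decrease along a morphism of models** `q : Z' → Z`: if `T` is
defined at `q z'` then `q ∘ T` is defined at `z'` (`𝒪_{Z,q z'} ⊆ 𝒪_{Z',z'}` dominated, and a
centre of the smaller local ring is a centre of the larger, `ProjModel.HasCentre.mono`).
[cite: ZariskiSamuel1960, Ch. VI §17] -/
theorem not_mem_fundamentalLocus_of_hom {Z' Z : ProjModel k K} (X : ProjModel k K) (q : Z'.Hom Z)
    {z' : Z'.X} (h : q.f z' ∉ fundamentalLocus Z X) : z' ∉ fundamentalLocus Z' X := by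
  intro h'
  rw [mem_fundamentalLocus_iff, not_not] at h
  exact h' (h.mono (ProjModel.stalkSubring_dominates_of_hom q z'))

/-- Set form: the fundamental locus of `q ∘ T` lies over that of `T`. [cite: ZariskiSamuel1960, Ch. VI §17] -/
theorem fundamentalLocus_subset_preimage {Z' Z : ProjModel k K} (X : ProjModel k K)
    (q : Z'.Hom Z) : fundamentalLocus Z' X ⊆ q.f ⁻¹' fundamentalLocus Z X := by
  intro z' hz'
  by_contra h
  exact not_mem_fundamentalLocus_of_hom X q h hz'

/-- **`T : Z ⋯→ X` is a morphism of models iff it has no fundamental point** (Zariski–Samuel II,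
Ch. VI §17: `Z` dominates `X` iff every local ring of `Z` has a centre on `X`; Hartshorne II
Thm. 7.1).  (→) `fundamentalLocus_eq_empty_of_hom`.  (←) in coordinates the rational map is
defined on the open `W = Z`, hence a `k`-morphism `W → X` compatible with the `K`-points
(`ProjModel.exists_hom_of_isDefinedAt`), transported along `Z ≅ (⊤ : Z.Opens)`
(`Scheme.topIso`).  PROVED. [cite: ZariskiSamuel1960, Ch. VI §17] -/
theorem nonempty_hom_iff_fundamentalLocus_eq_empty (Z X : ProjModel k K) :
    Nonempty (Z.Hom X) ↔ fundamentalLocus Z X = ∅ := by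
  classical
  refine ⟨fun ⟨φ⟩ => fundamentalLocus_eq_empty_of_hom φ, fun hF => ?_⟩
  /- coordinates for `X` -/
  obtain ⟨n, ι₁', hι₁'⟩ := X.isProjectiveOver
  let ι₁ : X.X ⟶ Proj (Segre.grading (Fin (n + 1)) k) := ι₁'.left
  haveI : IsClosedImmersion ι₁ := hι₁'
  have hι₁w : ι₁ ≫ Segre.toSpec (Fin (n + 1)) k = X.π := Over.w ι₁'
  let P₁ : AlgPoints (projectiveSpace n k) K := ProjModel.genOver X ≫ ι₁'
  obtain ⟨w, hw, hPw⟩ := ProjectiveSpace.exists_eq_pointOfVec (k := k) (L := K) P₁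
  have hPw_left : X.gen ≫ ι₁ = (ProjectiveSpace.pointOfVec k w hw).left := by
    rw [← hPw]; rfl
  /- the rational map is defined on `W = ⊤` -/
  have hWne : ((⊤ : Z.X.Opens) : Set Z.X).Nonempty := by
    rw [Opens.coe_top]
    exact Set.univ_nonempty
  have hW : ∀ y ∈ (⊤ : Z.X.Opens), IsDefinedAt (fun l => Z.funFieldAlgEquiv.symm (w l)) y := by
    intro y _
    have hy : y ∉ fundamentalLocus Z X := by
      rw [hF]
      exact Set.notMem_empty y
    rw [mem_fundamentalLocus_iff, not_not] at hy
    exact (ProjModel.hasCentre_stalkSubring_iff_isDefinedAt Z X ι₁ hι₁w w hw hPw_left y).mp hy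
  obtain ⟨f₁, hf₁π, hf₁gen⟩ :=
    ProjModel.exists_hom_of_isDefinedAt Z X ι₁ hι₁w w hw hPw_left ⊤ hWne hW
  refine ⟨{ f := Z.X.topIso.inv ≫ f₁, f_π := ?_, gen_f := ?_ }⟩
  · rw [Category.assoc, hf₁π, ← Category.assoc, Scheme.toIso_inv_ι, Category.id_comp]
  · rw [← Z.genLift_ι hWne, Category.assoc, ← Category.assoc (Scheme.Opens.ι _),
      Scheme.ι_toIso_inv, Category.id_comp, hf₁gen]

/-! ## Proposition 4.8 VERBATIM -/

/-- **Cossart–Piltant 2008, Proposition 4.8 (= Zariski [46] Theorem 7, any base field)** (HAL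
p. 15), VERBATIM: "Let `T : Z ⋯→ X` be a birational map between three-dimensional integral
projective varieties over `k` and `F ⊂ Z` be its fundamental locus. There exists a composition
of blowing ups with regular centers `q : Z′ → Z` such that no point of `q⁻¹(F ∩ Z_reg)` is
fundamental for `q ∘ T`."  AS PRINTED, in the dictionary of the module docstring: `Z`, `X`
projective models of a function field `K/k` of transcendence degree three (`T` their
birational correspondence, `F = fundamentalLocus Z X`); `q : Z' → Z` a morphism of models which
is a composition of blowing ups with (proper, integral) regular centres
(`IsRegularCentreBlowupComposition q.f`); conclusion: every `z' ∈ Z'` with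
`q z' ∈ F ∩ Reg Z` is not a fundamental point of `Z' ⋯→ X`.  Any field `k`.  Equivalent to the
same statement with `q⁻¹(Z_reg)` in place of `q⁻¹(F ∩ Z_reg)`
(`eliminationOfRegularFundamentalPoints_iff_over_regularLocus`); proved below for REGULAR `Z`
from `CossartPiltant2019Principalization`, and for all `Z` in the form of Piltant's Axiom 4
(regular centres over `Z_reg` only).  Named statement, used only as a hypothesis.
[cite: CossartPiltant2008, Prop 4.8 (HAL p. 15)]
[cite: ZariskiSamuel1960, Ch. VI §17] -/
def EliminationOfRegularFundamentalPoints : Prop :=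
  ∀ (k K : Type u) [Field k] [Field K] [Algebra k K], Algebra.trdeg k K = 3 →
    ∀ (Z X : ProjModel k K), ∃ (Z' : ProjModel k K) (q : Z'.Hom Z),
      IsRegularCentreBlowupComposition q.f ∧
        ∀ z' : Z'.X, q.f z' ∈ fundamentalLocus Z X ∩ Scheme.regularLocus Z.X →
          z' ∉ fundamentalLocus Z' X

/-- **The printed restriction to `F` is cosmetic**: Prop 4.8 is equivalent to "there is a
composition of blowing ups with regular centers `q : Z' → Z` such that no point of `q⁻¹(Z_reg)`
is fundamental for `q ∘ T`" — at a point over `Z_reg ∖ F` the map `T`, hence `q ∘ T`, is defined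
(`not_mem_fundamentalLocus_of_hom`).  PROVED (bookkeeping). [cite: CossartPiltant2008, Prop 4.8 (HAL p. 15)] -/
theorem eliminationOfRegularFundamentalPoints_iff_over_regularLocus :
    EliminationOfRegularFundamentalPoints.{u} ↔
      ∀ (k K : Type u) [Field k] [Field K] [Algebra k K], Algebra.trdeg k K = 3 →
        ∀ (Z X : ProjModel k K), ∃ (Z' : ProjModel k K) (q : Z'.Hom Z),
          IsRegularCentreBlowupComposition q.f ∧
            ∀ z' : Z'.X, q.f z' ∈ Scheme.regularLocus Z.X → z' ∉ fundamentalLocus Z' X := by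
  constructor
  · intro h k K _ _ _ htr Z X
    obtain ⟨Z', q, hq, hF⟩ := h k K htr Z X
    refine ⟨Z', q, hq, fun z' hz' => ?_⟩
    by_cases hm : q.f z' ∈ fundamentalLocus Z X
    · exact hF z' ⟨hm, hz'⟩
    · exact not_mem_fundamentalLocus_of_hom X q hm
  · intro h k K _ _ _ htr Z X
    obtain ⟨Z', q, hq, hF⟩ := h k K htr Z X
    exact ⟨Z', q, hq, fun z' hz' => hF z' hz'.2⟩

/-- The identity morphism of a projective model. [folklore] -/
def homId (Z : ProjModel k K) : Z.Hom Z where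
  f := 𝟙 Z.X
  f_π := Category.id_comp _
  gen_f := Category.comp_id _

/-- Non-vacuity of the printed conclusion shape: if `Z` already dominates `X` (e.g. `X = Z`),
then `F = ∅` and the empty composition `q = 𝟙` does it. PROVED. [folklore] -/
theorem exists_comp_of_hom {Z X : ProjModel k K} (φ : Z.Hom X) :
    ∃ (Z' : ProjModel k K) (q : Z'.Hom Z), IsRegularCentreBlowupComposition q.f ∧
      ∀ z' : Z'.X, z' ∉ fundamentalLocus Z' X :=
  ⟨Z, homId Z, IsRegularCentreBlowupComposition.nil Z.X, fun z' hz' => by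
    rw [fundamentalLocus_eq_empty_of_hom φ] at hz'
    exact hz'⟩

/-! ## Proposition 4.8 for regular `Z`, from Cossart–Piltant's principalization -/

/-- **Prop 4.8 for a REGULAR projective threefold model `Z`** (the case `U = Z_reg = Z` of the
printed proof, where device 2- is void), PROVED from the named fact
`CossartPiltant2019Principalization` ([CP-II] Prop. 4.4 = [CP-I] Prop. 4.2): choose a closed
`k`-immersion `X ↪ ℙⁿ_k` and homogeneous coordinates `w` of the generic point of `X`; the base
ideal of `(w₀ : … : wₙ)` read in `K(Z)` (`baseIdeal`, the ideal `I|_U` of the text) is a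
non-zero ideal sheaf on the regular, excellent (`Stacks07QW_field_holds`), integral Noetherian
threefold `Z`; its Cossart–Piltant principalization `σ : S' → Z` is a composition of blowing ups
with regular centres, proper, birational and projective over `k`, so `S'` is a projective model
`Z'` dominating `Z` (`ProjModel.ofModification`); and where the inverse image of the base ideal
is locally principal the coordinate vector is defined (Hartshorne II 7.17.3,
`forall_isDefinedAt_of_isLocallyPrincipal_comap`), i.e. `Z' ⋯→ X` has no fundamental
point at all. [cite: CossartPiltant2008, Prop 4.8 (HAL p. 15), proof]
[cite: Hartshorne1977, II Example 7.17.3 (pp. 168–169)] -/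
theorem exists_comp_forall_not_mem_fundamentalLocus_of_isRegular
    (hP : CossartPiltant2019Principalization.{u}) (Z X : ProjModel k K)
    (hdim : topologicalKrullDim Z.X = 3) (hreg : Scheme.IsRegular Z.X) :
    ∃ (Z' : ProjModel k K) (q : Z'.Hom Z), IsRegularCentreBlowupComposition q.f ∧
      ∀ z' : Z'.X, z' ∉ fundamentalLocus Z' X := by
  classical
  /- a projective embedding `ι₁ : X ↪ ℙⁿ_k` and homogeneous coordinates `w ∈ Kⁿ⁺¹` of the
    generic point of `X` -/
  obtain ⟨n, ι₁', hι₁'⟩ := X.isProjectiveOver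
  let ι₁ : X.X ⟶ Proj (Segre.grading (Fin (n + 1)) k) := ι₁'.left
  haveI : IsClosedImmersion ι₁ := hι₁'
  have hι₁w : ι₁ ≫ Segre.toSpec (Fin (n + 1)) k = X.π := Over.w ι₁'
  let P₁ : AlgPoints (projectiveSpace n k) K := ProjModel.genOver X ≫ ι₁'
  obtain ⟨w, hw, hPw⟩ := ProjectiveSpace.exists_eq_pointOfVec (k := k) (L := K) P₁
  have hPw_left : X.gen ≫ ι₁ = (ProjectiveSpace.pointOfVec k w hw).left := by
    rw [← hPw]; rfl
  /- the rational map `Z ⋯→ X ⊆ ℙⁿ_k` in coordinates and its base ideal -/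
  let z : Fin (n + 1) → Z.X.functionField := fun l => Z.funFieldAlgEquiv.symm (w l)
  have hz : z ≠ 0 := ProjectiveSpace.algHom_comp_ne_zero Z.funFieldAlgEquiv.symm.toAlgHom hw
  have hz' : ∃ i, z i ≠ 0 := by
    by_contra h
    push Not at h
    exact hz (funext h)
  have hJ : baseIdeal z ≠ ⊥ := baseIdeal_ne_bot hz'
  /- principalize on the regular excellent threefold `Z` -/
  have hexc : Scheme.IsExcellent Z.X :=
    Scheme.isExcellent_of_locallyOfFiniteType Stacks07QW_field_holds Z.π
  obtain ⟨S', σ, hσ, hprinc⟩ := hP Z.X hreg hexc hdim (baseIdeal z) hJ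
  have hcomp : IsRegularCentreBlowupComposition σ :=
    IsRegularCentreBlowupComposition.of_isRegularCentreBlowupSeq hσ inferInstance inferInstance hJ
  haveI : IsIntegral S' := hcomp.isIntegral inferInstance
  have hbir : IsBirational σ := hcomp.isBirational inferInstance
  have hproj : Motives.IsProjectiveOver (Over.mk (σ ≫ Z.π) : SchemeOver k) :=
    hcomp.isProjectiveOver Z.π Z.isProjectiveOver
  /- `S'` as a projective model `Z'` dominating `Z` -/
  obtain ⟨U₀, hU₀, hiso⟩ := Z.exists_nonempty_isIso_morphismRestrict hbir
  haveI := hiso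
  let Z' : ProjModel k K := ProjModel.ofModification Z σ U₀ hU₀ hproj
  let q : Z'.Hom Z := ProjModel.ofModificationHom Z σ U₀ hU₀ hproj
  have hqf : q.f = σ := rfl
  haveI : IsDominant σ := q.isDominant
  refine ⟨Z', q, hcomp, fun z' hz'F => hz'F ?_⟩
  /- the transported coordinate vector is defined everywhere on `Z'` -/
  have hdef : IsDefinedAt (fun l => RatFn.functionFieldMap σ (z l)) z' :=
    forall_isDefinedAt_of_isLocallyPrincipal_comap σ hz' hprinc z'
  have hzeq : (fun l => RatFn.functionFieldMap σ (z l)) = fun l => Z'.funFieldAlgEquiv.symm (w l) :=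
    funext fun l => ProjModel.functionFieldMap_funFieldIso_inv q (w l)
  rw [hzeq] at hdef
  exact (ProjModel.hasCentre_stalkSubring_iff_isDefinedAt Z' X ι₁ hι₁w w hw hPw_left z').mpr hdef

/-- **Elimination of the indeterminacies of `T : Z ⋯→ X` for a regular projective threefold
model `Z`**: `Z ← Z' → X` with `Z' → Z` a composition of blowing ups with regular centers and
`Z' → X` a MORPHISM of models (`nonempty_hom_iff_fundamentalLocus_eq_empty`).  PROVED from
`CossartPiltant2019Principalization`. [cite: CossartPiltant2008, Prop 4.8 (HAL p. 15), proof (case `U = Z`)] -/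
theorem exists_comp_nonempty_hom_of_isRegular (hP : CossartPiltant2019Principalization.{u})
    (Z X : ProjModel k K) (hdim : topologicalKrullDim Z.X = 3) (hreg : Scheme.IsRegular Z.X) :
    ∃ (Z' : ProjModel k K) (q : Z'.Hom Z), IsRegularCentreBlowupComposition q.f ∧
      Nonempty (Z'.Hom X) := by
  obtain ⟨Z', q, hq, hF⟩ := exists_comp_forall_not_mem_fundamentalLocus_of_isRegular hP Z X hdim hreg
  exact ⟨Z', q, hq, (nonempty_hom_iff_fundamentalLocus_eq_empty Z' X).mpr
    (Set.eq_empty_iff_forall_notMem.mpr hF)⟩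

/-- The same for function fields of transcendence degree three (`dim Z = trdeg_k K`).
[cite: CossartPiltant2008, Prop 4.8 (HAL p. 15)] -/
theorem exists_comp_forall_not_mem_fundamentalLocus_of_isRegular_of_trdeg
    (hP : CossartPiltant2019Principalization.{u}) (htr : Algebra.trdeg k K = 3)
    (Z X : ProjModel k K) (hreg : Scheme.IsRegular Z.X) :
    ∃ (Z' : ProjModel k K) (q : Z'.Hom Z), IsRegularCentreBlowupComposition q.f ∧
      ∀ z' : Z'.X, z' ∉ fundamentalLocus Z' X :=
  exists_comp_forall_not_mem_fundamentalLocus_of_isRegular hP Z X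
    (by rw [Z.topologicalKrullDim_eq_of_trdeg htr]; rfl) hreg

/-! ## Proposition 4.8 over the regular locus, in the form of Piltant's Axiom 4 -/

/-- **Prop 4.8 over `Z_reg` for an arbitrary projective model `Z`, in the form of Piltant's
Axiom 4** ([cite: Piltant2013, §2 Axiom 4 (i)–(iii)]; steps (2)–(7) of Piltant 2013, Prop. 5.1,
Step 2 as run in `ProjModel.exists_hom_regLe_isIso_of_regPrincipalization`): if every non-zero
ideal sheaf on the open subscheme `Z_reg` is principalized by a Cossart–Piltant sequence (`hPr`;
in dimension three this is `CossartPiltant2019Principalization`,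
`ProjModel.regPrincipalization_of_principalization`), then there is a projective model `Z'` with
a morphism of models `q : Z' → Z` such that: (i) over `Z_reg`, `q` is the base change of a
composition `σ` of blowing ups with regular centers (a cartesian square with open immersions
`Z_reg ↪ Z`, `S' ↪ Z'`); (ii) `q⁻¹(Z_reg) ⊆ Reg Z'` (`q.RegLe`); (iii) `q` is an isomorphism over
every open of `Z` missing the closure of `F ∩ Z_reg`; (iv) no point of `q⁻¹(Z_reg)` — in
particular no point of `q⁻¹(F ∩ Z_reg)` — is fundamental for `q ∘ T : Z' ⋯→ X`.  (The printed
`q` moreover has regular centres over all of `Z`; see the module docstring, DEVIATION.)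
[cite: CossartPiltant2008, Prop 4.8 (HAL p. 15)] [cite: Piltant2013, §2 Axiom 4; Prop. 5.1 (proof, Step 2)] -/
theorem exists_hom_forall_not_mem_fundamentalLocus_of_regPrincipalization (Z X : ProjModel k K)
    (hPr : ∀ (U : Z.X.Opens), (U : Set Z.X) = Scheme.regularLocus Z.X →
      ∀ J : (U : Scheme.{u}).IdealSheafData, J ≠ ⊥ →
        ∃ (S' : Scheme.{u}) (σ : S' ⟶ U), IsRegularCentreBlowupSeq σ J ∧
          IsLocallyPrincipal (J.comap σ)) :
    ∃ (Z' : ProjModel k K) (q : Z'.Hom Z),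
      (∃ (U : Z.X.Opens) (S' : Scheme.{u}) (σ : S' ⟶ U) (j' : S' ⟶ Z'.X),
          (U : Set Z.X) = Scheme.regularLocus Z.X ∧ IsRegularCentreBlowupComposition σ ∧
            IsOpenImmersion j' ∧ IsPullback j' σ q.f U.ι) ∧
      q.RegLe ∧
      (∀ V : Z.X.Opens, Disjoint (V : Set Z.X)
          (closure (fundamentalLocus Z X ∩ Scheme.regularLocus Z.X)) → IsIso (q.f ∣_ V)) ∧
      ∀ z' : Z'.X, q.f z' ∈ Scheme.regularLocus Z.X → z' ∉ fundamentalLocus Z' X := by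
  classical
  /- (1) a projective embedding `ι₁ : X ↪ ℙⁿ_k` and homogeneous coordinates `w ∈ Kⁿ⁺¹` of the
    generic point of `X` -/
  obtain ⟨n, ι₁', hι₁'⟩ := X.isProjectiveOver
  let ι₁ : X.X ⟶ Proj (Segre.grading (Fin (n + 1)) k) := ι₁'.left
  haveI : IsClosedImmersion ι₁ := hι₁'
  have hι₁w : ι₁ ≫ Segre.toSpec (Fin (n + 1)) k = X.π := Over.w ι₁'
  let P₁ : AlgPoints (projectiveSpace n k) K := ProjModel.genOver X ≫ ι₁'
  obtain ⟨w, hw, hPw⟩ := ProjectiveSpace.exists_eq_pointOfVec (k := k) (L := K) P₁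
  have hPw_left : X.gen ≫ ι₁ = (ProjectiveSpace.pointOfVec k w hw).left := by
    rw [← hPw]; rfl
  /- (2) the rational map `Z ⋯→ X ⊆ ℙⁿ_k` in coordinates -/
  let z : Fin (n + 1) → Z.X.functionField := fun l => Z.funFieldAlgEquiv.symm (w l)
  have hz : z ≠ 0 := ProjectiveSpace.algHom_comp_ne_zero Z.funFieldAlgEquiv.symm.toAlgHom hw
  have hz' : ∃ i, z i ≠ 0 := by
    by_contra h
    push Not at h
    exact hz (funext h)
  /- (3) the regular locus `U` of `Z` (a regular integral open subscheme) -/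
  have hqe : Scheme.IsQuasiExcellent Z.X :=
    (Scheme.isExcellent_of_locallyOfFiniteType Stacks07QW_field_holds Z.π).isQuasiExcellent
  obtain ⟨U, hU⟩ := Scheme.exists_opens_coe_eq_regularLocus hqe
  have hUne : (U : Set Z.X).Nonempty := by
    rw [hU]; exact (Scheme.dense_regularLocus Z.X).nonempty
  haveI : Nonempty (U : Scheme.{u}) := hUne.to_subtype
  haveI hintU : IsIntegral (U : Scheme.{u}) := isIntegral_of_isOpenImmersion U.ι
  have hregU : Scheme.IsRegular (U : Scheme.{u}) := fun x => by
    have hx : (U.ι x) ∈ Scheme.regularLocus Z.X := by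
      rw [← hU, Scheme.Opens.ι_apply]; exact x.2
    haveI : IsRegularLocalRing (Z.X.presheaf.stalk (U.ι x)) := hx
    exact IsRegularLocalRing.of_ringEquiv (asIso (U.ι.stalkMap x)).commRingCatIsoToRingEquiv
  /- (4) the base ideal of the rational map, restricted to `U`, is non-zero -/
  let J : (U : Scheme.{u}).IdealSheafData := (baseIdeal z).comap U.ι
  have hJ : J ≠ ⊥ := by
    intro hbot
    let y : (U : Scheme.{u}) := Classical.arbitrary _
    have h1 : stalkIdeal J y = ⊥ := by rw [hbot, stalkIdeal_bot]
    rw [stalkIdeal_comap_of_isOpenImmersion] at h1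
    obtain ⟨b, hb, hb0⟩ :=
      (Submodule.ne_bot_iff _).mp (stalkIdeal_baseIdeal_ne_bot hz' (U.ι y))
    apply hb0
    have hb' : (U.ι.stalkMap y).hom b ∈
        (stalkIdeal (baseIdeal z) (U.ι y)).map (U.ι.stalkMap y).hom :=
      Ideal.mem_map_of_mem _ hb
    rw [h1, Ideal.mem_bot] at hb'
    exact (asIso (U.ι.stalkMap y)).commRingCatIsoToRingEquiv.injective
      (hb'.trans (map_zero _).symm)
  /- (5) principalize on `U` and extend to `Z`, with the iso locus -/
  obtain ⟨S', σ, hσ, hprinc⟩ := hPr U hU J hJ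
  obtain ⟨X', ρ, j', hj', hpb, hprop, hint', hbir, hproj, hregS', hover, hisoP⟩ :=
    hσ.exists_extension_full hregU hJ U.ι
  haveI := hj'
  haveI := hint'
  haveI := hprop
  haveI := hisoP
  haveI : IsLocallyNoetherian X' := LocallyOfFiniteType.isLocallyNoetherian ρ
  haveI : IsIntegral S' := hσ.isIntegral hJ
  have hcomp : IsRegularCentreBlowupComposition σ :=
    IsRegularCentreBlowupComposition.of_isRegularCentreBlowupSeq hσ inferInstance inferInstance hJ
  /- (6) `X'` as a projective model `Z'` dominating `Z`, regular over `U` -/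
  have hproj₂ : Motives.IsProjectiveOver (Over.mk (ρ ≫ Z.π) : SchemeOver k) :=
    hproj k Z.π Z.isProjectiveOver
  obtain ⟨U₀, hU₀, hiso⟩ := Z.exists_nonempty_isIso_morphismRestrict hbir
  haveI := hiso
  let Z' : ProjModel k K := ProjModel.ofModification Z ρ U₀ hU₀ hproj₂
  let q : Z'.Hom Z := ProjModel.ofModificationHom Z ρ U₀ hU₀ hproj₂
  have hqf : q.f = ρ := rfl
  have hregX' : ∀ y : X', ρ y ∈ (U : Set Z.X) → IsRegularLocalRing (X'.presheaf.stalk y) := by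
    intro y hy
    obtain ⟨s', rfl⟩ := hover y (by rwa [Scheme.Opens.range_ι])
    haveI := hregS' s'
    exact IsRegularLocalRing.of_ringEquiv (asIso (j'.stalkMap s')).commRingCatIsoToRingEquiv.symm
  /- (7) the transported rational map `z'` on `X'` is defined over `j'(S') = ρ⁻¹(U)` -/
  haveI : IsDominant ρ := q.isDominant
  let z' : Fin (n + 1) → X'.functionField := fun l => RatFn.functionFieldMap ρ (z l)
  have hz'eq : z' = fun l => Z'.funFieldAlgEquiv.symm (w l) :=
    funext fun l => ProjModel.functionFieldMap_funFieldIso_inv q (w l)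
  have hdef' : ∀ s' : S', IsDefinedAt z' (j' s') := by
    intro s'
    refine isDefinedAt_of_isLocallyPrincipalAt_comap ρ hz'
      (isLocallyPrincipalAt_of_comap_isOpenImmersion j' _ ?_)
    have h := hprinc s'
    have hJσ : J.comap σ = ((baseIdeal z).comap ρ).comap j' := by
      change ((baseIdeal z).comap U.ι).comap σ = _
      rw [← Scheme.IdealSheafData.comap_comp, ← Scheme.IdealSheafData.comap_comp, hpb.w]
    rwa [hJσ] at h
  /- (8) the closure of the regular fundamental locus is the closure of `U.ι(F_J)`, `F_J` the
    non-locally-principal locus of `J` -/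
  have hFz : fundamentalLocus Z X = {m | ¬ IsDefinedAt z m} :=
    fundamentalLocus_eq_setOf_not_isDefinedAt Z X ι₁ hι₁w w hw hPw_left
  have hF : U.ι '' (nonPrincipalLocus J : Set U) = fundamentalLocus Z X ∩
      Scheme.regularLocus Z.X := by
    rw [hFz]
    ext m
    constructor
    · rintro ⟨u, hu, rfl⟩
      refine ⟨fun hdef => hu ((isLocallyPrincipalAt_baseIdeal hdef).comap U.ι), ?_⟩
      rw [← hU]; exact u.2
    · rintro ⟨hm, hmreg⟩
      rw [← hU] at hmreg
      refine ⟨⟨m, hmreg⟩, fun hu => hm ?_, rfl⟩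
      exact (isDefinedAt_iff_isLocallyPrincipalAt (z := z) hz').mpr
        (isLocallyPrincipalAt_of_comap_isOpenImmersion U.ι _ hu)
  refine ⟨Z', q, ⟨U, S', σ, j', hU, hcomp, hj', hpb⟩, fun y hy => ?_, fun V hV => ?_,
    fun y hy hyF => hyF ?_⟩
  /- (ii) regularity over `U` -/
  · rw [hqf] at hy
    exact hregX' y (by rw [hU]; exact hy)
  /- (iii) `q = ρ` is an isomorphism over every open missing the closure of `U.ι(F_J)` -/
  · have hVP : V ≤ principalOpen U.ι J := by
      intro m hm hmem
      rw [coe_closureImage, hF] at hmem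
      exact Set.disjoint_left.mp hV hm hmem
    rw [hqf]
    exact isIso_morphismRestrict_of_le ρ hisoP hVP
  /- (iv) no fundamental point over `U` -/
  · rw [hqf] at hy
    have hyU : ρ y ∈ (U : Set Z.X) := by rw [hU]; exact hy
    obtain ⟨s', hs'⟩ := hover y (by rwa [Scheme.Opens.range_ι])
    have hdef : IsDefinedAt (fun l => Z'.funFieldAlgEquiv.symm (w l)) y := by
      rw [← hz'eq, ← hs']
      exact hdef' s'
    exact (ProjModel.hasCentre_stalkSubring_iff_isDefinedAt Z' X ι₁ hι₁w w hw hPw_left y).mpr hdef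

/-- **Prop 4.8 over `Z_reg` (Piltant's Axiom-4 form) for projective threefold models**, from
`CossartPiltant2019Principalization` on the regular locus
(`ProjModel.regPrincipalization_of_principalization`). [cite: CossartPiltant2008, Prop 4.8 (HAL p. 15)]
[cite: Piltant2013, §2 Axiom 4; §4.1 (Axiom 4 for `P = P_reg` is [CP-I] Prop. 4.2)] -/
theorem exists_hom_forall_not_mem_fundamentalLocus_of_principalization
    (hP : CossartPiltant2019Principalization.{u}) (Z X : ProjModel k K)
    (hdim : topologicalKrullDim Z.X = 3) :
    ∃ (Z' : ProjModel k K) (q : Z'.Hom Z),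
      (∃ (U : Z.X.Opens) (S' : Scheme.{u}) (σ : S' ⟶ U) (j' : S' ⟶ Z'.X),
          (U : Set Z.X) = Scheme.regularLocus Z.X ∧ IsRegularCentreBlowupComposition σ ∧
            IsOpenImmersion j' ∧ IsPullback j' σ q.f U.ι) ∧
      q.RegLe ∧
      (∀ V : Z.X.Opens, Disjoint (V : Set Z.X)
          (closure (fundamentalLocus Z X ∩ Scheme.regularLocus Z.X)) → IsIso (q.f ∣_ V)) ∧
      ∀ z' : Z'.X, q.f z' ∈ Scheme.regularLocus Z.X → z' ∉ fundamentalLocus Z' X :=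
  exists_hom_forall_not_mem_fundamentalLocus_of_regPrincipalization Z X
    (ProjModel.regPrincipalization_of_principalization hP Z hdim)

/-- The same for function fields of transcendence degree three (`dim Z = trdeg_k K`), the
quantifier shape of the verbatim Prop 4.8. [cite: CossartPiltant2008, Prop 4.8 (HAL p. 15)] -/
theorem exists_hom_forall_not_mem_fundamentalLocus_of_trdeg
    (hP : CossartPiltant2019Principalization.{u}) (htr : Algebra.trdeg k K = 3)
    (Z X : ProjModel k K) :
    ∃ (Z' : ProjModel k K) (q : Z'.Hom Z),
      (∃ (U : Z.X.Opens) (S' : Scheme.{u}) (σ : S' ⟶ U) (j' : S' ⟶ Z'.X),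
          (U : Set Z.X) = Scheme.regularLocus Z.X ∧ IsRegularCentreBlowupComposition σ ∧
            IsOpenImmersion j' ∧ IsPullback j' σ q.f U.ι) ∧
      q.RegLe ∧
      (∀ V : Z.X.Opens, Disjoint (V : Set Z.X)
          (closure (fundamentalLocus Z X ∩ Scheme.regularLocus Z.X)) → IsIso (q.f ∣_ V)) ∧
      ∀ z' : Z'.X, q.f z' ∈ Scheme.regularLocus Z.X → z' ∉ fundamentalLocus Z' X :=
  exists_hom_forall_not_mem_fundamentalLocus_of_principalization hP Z X
    (by rw [Z.topologicalKrullDim_eq_of_trdeg htr]; rfl)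

/-! ## The printed reduction of Prop 4.9 to [12] and Props 4.7, 4.8 -/

/-- **[CP-I] p. 15, lines 39–42, as a named implication**: "we need the following refinement of
Zariski's patching theorem which is due to the first author [12]. The proof in [12] is written
for `k` algebraically closed, but only uses this assumption via propositions 4.7 and 4.8 above.
Since these results have been seen to be valid for any ground field `k`, we thus have:
Proposition 4.9."  Rendered: Prop 4.7 (`AbhyankarQuadraticFactorization`, [2] Thm 3 — a
THEOREM of the tree, `AbhyankarQuadraticFactorization_holds`) and Prop 4.8
(`EliminationOfRegularFundamentalPoints`) imply Prop 4.9 as printed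
(`RefinedPatchingQuasiProjective`).  The implication is the content of [12] (V. Cossart, Modèle
projectif régulier et désingularisation, Math. Ann. 293(1) (1992) 115–122; not held) read over an
arbitrary field; named statement, NOT proved here, used only as a hypothesis.
[cite: CossartPiltant2008, p. 15 lines 39–42 and Prop 4.9 (HAL pp. 15–16)] -/
def RefinedPatchingOfProps47And48 : Prop :=
  AbhyankarQuadraticFactorization.{u} → EliminationOfRegularFundamentalPoints.{u} →
    RefinedPatchingQuasiProjective.{u}

/-- **Given [12]'s reduction, the printed Prop 4.9 follows from Prop 4.8 alone**, Prop 4.7 being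
the tree's theorem `AbhyankarQuadraticFactorization_holds`.  PROVED (modus ponens).
[cite: CossartPiltant2008, p. 15 lines 39–42 (HAL)] -/
theorem refinedPatchingQuasiProjective_of_props47And48 (h12 : RefinedPatchingOfProps47And48.{u})
    (h48 : EliminationOfRegularFundamentalPoints.{u}) : RefinedPatchingQuasiProjective.{u} :=
  h12 AbhyankarQuadraticFactorization_holds h48

/-- Hence also the tree's affine rendering `Threefolds2008.RefinedPatching`
(`refinedPatching_of_refinedPatchingQuasiProjective`). PROVED.
[cite: CossartPiltant2008, Prop 4.9 (HAL pp. 15–16)] -/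
theorem refinedPatching_of_props47And48 (h12 : RefinedPatchingOfProps47And48.{u})
    (h48 : EliminationOfRegularFundamentalPoints.{u}) : RefinedPatching.{u} :=
  refinedPatching_of_refinedPatchingQuasiProjective
    (refinedPatchingQuasiProjective_of_props47And48 h12 h48)

end Literature.AlgebraicGeometry.CossartPiltant200819.CP2008

end
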